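import Mathlib
import HarnessLib
import Literature.MathematicalPhysics.QuantumLattice.HubbardBandSectorCountingCounts
import Summits.HubbardSuperconductivity.HubbardSuperconductivity.Theorems.KLProgrammeCountPairsOffsetDeriv
import Summits.HubbardSuperconductivity.HubbardSuperconductivity.Theorems.KLProgrammeCountPairsOffsetNondegP
import Summits.HubbardSuperconductivity.HubbardSuperconductivity.Theorems.KLProgrammeCountPairsOffsetGridCount

/-!
# Route `KLProgramme` — support item `CountPairsOffset` (stmt-HubbardSuperconductivity-20036):
# the grid counts for an arbitrary offset — transversal families, reindexing, and the Cooper range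

With `w` the grid spacing (`N w = 2π`), `θ_i = w/2 + i w`, and the offset level function `h_P`: the transversal families
(`count_transversalP`, verbatim port), the reindexing by the shift and the three shift ranges (`count_reindexP`, `krangeP`,
verbatim ports using `coverP`), and the NEW Cooper range for an arbitrary offset: along a shift line `θ₃ = θ₂ + c`,
`0 < |c - π| ≤ τ`, the count is GATED by the leg-2 partial (`count_odd_shift_offset`, via `gridCount_L3G` and
`odd_transversalP`; the gate's Lipschitz bound is `abs_h3P_shift_sub_le`), and summing the shifts gives the harmonic
`log N` (`count_odd_total_offset`: `≤ N + 2C₅((2δ/(h_min w))·2(1 + log N)/w + N)`, no `η_o`).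
References: G. Benfatto, A. Giuliani, V. Mastropietro, Ann. Henri Poincaré 7 (2006) 809–898, Lemma 3.1, (2.76), (2.80),
App. A2; Ann. Henri Poincaré 4 (2003) 137–193, §7. Mathematics: HOME/prover-p4/COUNTING-NOTE.md (cell gate-hubbard-kl).
-/

noncomputable section

namespace Summit.HubbardSuperconductivity.HubbardSuperconductivity.Theorems.CountPairsOffset

set_option linter.dupNamespace false -- summit = problem name (single-conjunct summit), D-0017

open Real Set
open Literature.MathematicalPhysics.QuantumLattice Literature.MathematicalPhysics.QuantumLattice.BandSectorCounting

section Assembly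

variable {a b : ℝ} (B : BandBounds a b) {μ : ℝ} (hμ : μ ∈ Icc a b)
include B hμ

/-- **Transversal part** (fibre over `θ₂`): `Σ_{a<N} #{c<N : |h| ≤ δ, |∂₃h| ≥ λ} ≤ N·C₃`. -/
theorem count_transversalP {P : ℝ × ℝ} {w δ lam : ℝ} (hw : 0 < w) (hlam : 0 < lam) (hδ : 0 ≤ δ) {N : ℕ}
    (hN : (N : ℝ) * w = 2 * π) :
    ∑ i ∈ Finset.range N, ((((Finset.range N).filter fun c : ℕ =>
        |hfunP μ P (w / 2 + i * w) (w / 2 + c * w)| ≤ δ ∧ lam ≤ |h3P μ P (w / 2 + i * w) (w / 2 + c * w)|).card : ℝ)) ≤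
      N * ((2 * π / (lam / (2 * (4 * B.smax ^ 2 + 4 * B.A2))) + 1) * (2 * ((4 * δ / lam) / w + 1))) := by
  obtain ⟨h1, h2⟩ := B.level hμ
  have hA : 0 < 4 * B.smax ^ 2 + 4 * B.A2 := by have := B.smax_pos; have := B.A2_pos; positivity
  have hterm : ∀ i ∈ Finset.range N, ((((Finset.range N).filter fun c : ℕ =>
        |hfunP μ P (w / 2 + i * w) (w / 2 + c * w)| ≤ δ ∧ lam ≤ |h3P μ P (w / 2 + i * w) (w / 2 + c * w)|).card : ℝ)) ≤
      (2 * π / (lam / (2 * (4 * B.smax ^ 2 + 4 * B.A2))) + 1) * (2 * ((4 * δ / lam) / w + 1)) := by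
    intro i _
    have := gridCount_L2 (g := fun x => hfunP μ P (w / 2 + i * w) x) (g' := fun x => h3P μ P (w / 2 + i * w) x)
      (hasDerivAt_hfunP_three h1 h2 P _) hA hlam hδ (abs_h3P_sub_le B hμ P _) (x₀ := w / 2) hw N
    rw [hN] at this
    exact this
  calc _ ≤ ∑ i ∈ Finset.range N, (2 * π / (lam / (2 * (4 * B.smax ^ 2 + 4 * B.A2))) + 1) * (2 * ((4 * δ / lam) / w + 1)) :=
        Finset.sum_le_sum hterm
    _ = _ := by rw [Finset.sum_const, Finset.card_range, nsmul_eq_mul]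

/-- **Transversal part, other leg** (fibre over `θ₃`). -/
theorem count_transversalP' {P : ℝ × ℝ} {w δ lam : ℝ} (hw : 0 < w) (hlam : 0 < lam) (hδ : 0 ≤ δ) {N : ℕ}
    (hN : (N : ℝ) * w = 2 * π) :
    ∑ c ∈ Finset.range N, ((((Finset.range N).filter fun i : ℕ =>
        |hfunP μ P (w / 2 + i * w) (w / 2 + c * w)| ≤ δ ∧ lam ≤ |h3P μ P (w / 2 + c * w) (w / 2 + i * w)|).card : ℝ)) ≤
      N * ((2 * π / (lam / (2 * (4 * B.smax ^ 2 + 4 * B.A2))) + 1) * (2 * ((4 * δ / lam) / w + 1))) := by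
  have h := count_transversalP B hμ (P := P) hw hlam hδ hN
  refine le_trans (le_of_eq ?_) h
  refine Finset.sum_congr rfl fun c _ => ?_
  congr 2
  refine Finset.filter_congr fun i _ => ?_
  rw [hfunP_swap μ P (w / 2 + i * w) (w / 2 + c * w)]

/-- **Reindexing by the shift**: with `N w = 2π`, the pairs `(i, j)` of the region `R₀` (both partials `< λ`) are counted by
the shift `k = j - i (mod N)` and the first index; the `2π`-periodicity of `h_P` in each slot makes the reindexing exact
(verbatim port of the tree's `count_reindex` for an arbitrary offset). [folklore] -/
theorem count_reindexP {P : ℝ × ℝ} {w δ lam : ℝ} {N : ℕ} (hN : (N : ℝ) * w = 2 * π) :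
    ((((Finset.range N ×ˢ Finset.range N).filter fun p : ℕ × ℕ =>
        |hfunP μ P (w / 2 + p.1 * w) (w / 2 + p.2 * w)| ≤ δ ∧
        |h3P μ P (w / 2 + p.1 * w) (w / 2 + p.2 * w)| < lam ∧
        |h3P μ P (w / 2 + p.2 * w) (w / 2 + p.1 * w)| < lam).card : ℝ)) ≤
      ∑ k ∈ Finset.range N, ((((Finset.range N).filter fun i : ℕ =>
        |hfunP μ P (w / 2 + i * w) (w / 2 + i * w + k * w)| ≤ δ ∧
        |h3P μ P (w / 2 + i * w) (w / 2 + i * w + k * w)| < lam ∧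
        |h3P μ P (w / 2 + i * w + k * w) (w / 2 + i * w)| < lam).card : ℝ)) := by
  obtain ⟨h1, h2⟩ := B.level hμ
  rw [← card_filter_prod_eq_sum' N (fun i k =>
        |hfunP μ P (w / 2 + i * w) (w / 2 + i * w + k * w)| ≤ δ ∧
        |h3P μ P (w / 2 + i * w) (w / 2 + i * w + k * w)| < lam ∧
        |h3P μ P (w / 2 + i * w + k * w) (w / 2 + i * w)| < lam)]
  norm_cast
  refine Finset.card_le_card_of_injOn (fun p : ℕ × ℕ => (p.1, if p.1 ≤ p.2 then p.2 - p.1 else p.2 + N - p.1)) ?_ ?_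
  · intro p hp
    rw [Finset.mem_coe, Finset.mem_filter, Finset.mem_product, Finset.mem_range, Finset.mem_range] at hp
    obtain ⟨⟨ha, hc⟩, hQ⟩ := hp
    rw [Finset.mem_coe, Finset.mem_filter, Finset.mem_product, Finset.mem_range, Finset.mem_range]
    dsimp only
    refine ⟨⟨ha, ?_⟩, ?_⟩
    · split_ifs <;> omega
    · split_ifs with hle
      · have : w / 2 + (p.1 : ℝ) * w + ((p.2 - p.1 : ℕ) : ℝ) * w = w / 2 + p.2 * w := by
          rw [Nat.cast_sub hle]; ring
        rw [this]; exact hQ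
      · push Not at hle
        have : w / 2 + (p.1 : ℝ) * w + ((p.2 + N - p.1 : ℕ) : ℝ) * w = w / 2 + p.2 * w + (1 : ℤ) * (2 * π) := by
          rw [Nat.cast_sub (by omega : p.1 ≤ p.2 + N)]; push_cast; rw [← hN]; ring
        rw [this, hfunP_add_two_pi_three h1 h2, h3P_add_two_pi_three h1 h2, h3P_add_two_pi_two h1 h2]
        exact hQ
  · intro p hp q hq hpq
    rw [Finset.mem_coe, Finset.mem_filter, Finset.mem_product, Finset.mem_range, Finset.mem_range] at hp hq
    simp only [Prod.mk.injEq] at hpq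
    obtain ⟨h1', h2'⟩ := hpq
    have : p.2 = q.2 := by
      split_ifs at h2' <;> omega
    exact Prod.ext h1' this

/-- **The three shift ranges**: if along `θ₃ = θ₂ + k w` (`k < N`) the level function and both
partials are small somewhere, then `k w ≤ τ`, or `|k w - π| ≤ τ`, or `k w ≥ 2π - τ`. -/
theorem krangeP {P : ℝ × ℝ} {w δ lam τ η₀ : ℝ} (hw : 0 < w) {N k : ℕ} (hN : (N : ℝ) * w = 2 * π) (hk : k < N)
    (hτ : τ < π) (hlo : a ≤ μ - η₀) (hhi : μ + η₀ ≤ b) (hδη : δ ≤ η₀)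
    (hsmall : 2 * (B.Cg * (lam / 2 + 2 * B.smax * (η₀ / B.Dtmin))) ≤ τ) {x : ℝ}
    (hQ : |hfunP μ P x (x + k * w)| ≤ δ ∧ |h3P μ P x (x + k * w)| < lam ∧ |h3P μ P (x + k * w) x| < lam) :
    (k : ℝ) * w ≤ τ ∨ |(k : ℝ) * w - π| ≤ τ ∨ 2 * π - τ ≤ (k : ℝ) * w := by
  obtain ⟨j, hj⟩ := coverP B hμ hlo hhi (hQ.1.trans hδη) hQ.2.2.le hQ.2.1.le hsmall
  rw [show x + k * w - x = (k : ℝ) * w by ring] at hj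
  have hk0 : 0 ≤ (k : ℝ) * w := by positivity
  have hkN : (k : ℝ) * w < 2 * π := by
    calc (k : ℝ) * w < N * w := mul_lt_mul_of_pos_right (by exact_mod_cast hk) hw
      _ = 2 * π := hN
  have hτ0 : 0 ≤ τ := (abs_nonneg _).trans hj
  have hπ := Real.pi_pos
  have hjge : 0 ≤ j := by
    by_contra hneg
    push Not at hneg
    have : (j : ℝ) ≤ -1 := by exact_mod_cast Int.le_sub_one_of_lt hneg
    have h' := (abs_le.1 hj).2
    nlinarith
  have hjle : j ≤ 2 := by
    by_contra hneg
    push Not at hneg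
    have : (3 : ℝ) ≤ j := by exact_mod_cast hneg
    have h' := (abs_le.1 hj).1
    nlinarith
  interval_cases j
  · left; simpa using (abs_le.1 hj).2
  · right; left; simpa using hj
  · right; right
    have h' := (abs_le.1 hj).1
    push_cast at h'; linarith

/-- The `θ₂`-derivative of `θ₂ ↦ h(θ₂, θ₂ + c)` is at most `4 A₂ |c - π|`. -/
theorem abs_diag_deriv_oddP_le (P : ℝ × ℝ) (c x : ℝ) :
    |2 * Real.sin (SXP μ P x (x + c)) * (bandVX μ x + bandVX μ (x + c)) +
        2 * Real.sin (SYP μ P x (x + c)) * (bandVY μ x + bandVY μ (x + c))| ≤ 4 * B.A2 * |c - π| := by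
  obtain ⟨h1, h2⟩ := B.level hμ
  obtain ⟨-, -, hvx, hvy⟩ := band_add_pi h1 h2 (x + (c - π))
  rw [show x + (c - π) + π = x + c by ring] at hvx hvy
  have e1 : |bandVX μ x + bandVX μ (x + c)| ≤ B.A2 * |c - π| := by
    rw [hvx, ← sub_eq_add_neg]
    refine (abs_bandVX_sub_le B hμ _ _).trans ?_
    rw [show x - (x + (c - π)) = -(c - π) by ring, abs_neg]
  have e2 : |bandVY μ x + bandVY μ (x + c)| ≤ B.A2 * |c - π| := by
    rw [hvy, ← sub_eq_add_neg]
    refine (abs_bandVY_sub_le B hμ _ _).trans ?_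
    rw [show x - (x + (c - π)) = -(c - π) by ring, abs_neg]
  have hs1 : |2 * Real.sin (SXP μ P x (x + c))| ≤ 2 := by
    rw [abs_mul, abs_two]; linarith [Real.abs_sin_le_one (SXP μ P x (x + c))]
  have hs2 : |2 * Real.sin (SYP μ P x (x + c))| ≤ 2 := by
    rw [abs_mul, abs_two]; linarith [Real.abs_sin_le_one (SYP μ P x (x + c))]
  have := abs_two_term_le hs1 e1 hs2 e2
  linarith

/-! ## The grid counts: the Cooper range `|k w - π| ≤ τ` for an arbitrary offset -/

/-- The leg-2 partial along the shift line, `x ↦ ∂₂ h_P(x, x + c) = h3P(x + c, x)`, is differentiable. -/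
theorem hasDerivAt_h3P_shift (P : ℝ × ℝ) (c x : ℝ) :
    HasDerivAt (fun x => h3P μ P (x + c) x)
      (2 * (Real.cos (SXP μ P (x + c) x) * (bandVX μ (x + c) + bandVX μ x) * bandVX μ x +
          Real.sin (SXP μ P (x + c) x) * bandAX μ x) +
        2 * (Real.cos (SYP μ P (x + c) x) * (bandVY μ (x + c) + bandVY μ x) * bandVY μ x +
          Real.sin (SYP μ P (x + c) x) * bandAY μ x)) x := by
  obtain ⟨h1, h2⟩ := B.level hμ
  have hX : HasDerivAt (fun x => SXP μ P (x + c) x) (bandVX μ (x + c) + bandVX μ x) x := by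
    unfold SXP
    exact (((hasDerivAt_bandX h1 h2 (x + c)).comp_add_const x c).const_add _).fun_add (hasDerivAt_bandX h1 h2 x)
  have hY : HasDerivAt (fun x => SYP μ P (x + c) x) (bandVY μ (x + c) + bandVY μ x) x := by
    unfold SYP
    exact (((hasDerivAt_bandY h1 h2 (x + c)).comp_add_const x c).const_add _).fun_add (hasDerivAt_bandY h1 h2 x)
  have h := ((hX.sin.fun_mul (hasDerivAt_bandVX h1 h2 x)).const_mul 2).fun_add
    ((hY.sin.fun_mul (hasDerivAt_bandVY h1 h2 x)).const_mul 2)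
  unfold h3P
  refine (h.congr_deriv ?_).congr_of_eventuallyEq ?_
  · ring
  · exact Filter.Eventually.of_forall fun x => by ring

/-- The leg-2 partial along the shift line is Lipschitz with constant `8 s_max² + 4 A₂`. -/
theorem abs_h3P_shift_sub_le (P : ℝ × ℝ) (c z z' : ℝ) :
    |h3P μ P (z + c) z - h3P μ P (z' + c) z'| ≤ (8 * B.smax ^ 2 + 4 * B.A2) * |z - z'| := by
  have hs := B.smax_pos; have hA := B.A2_pos
  have hbound : ∀ x : ℝ,
      |2 * (Real.cos (SXP μ P (x + c) x) * (bandVX μ (x + c) + bandVX μ x) * bandVX μ x +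
          Real.sin (SXP μ P (x + c) x) * bandAX μ x) +
        2 * (Real.cos (SYP μ P (x + c) x) * (bandVY μ (x + c) + bandVY μ x) * bandVY μ x +
          Real.sin (SYP μ P (x + c) x) * bandAY μ x)| ≤ 8 * B.smax ^ 2 + 4 * B.A2 := by
    intro x
    have v1 := B.abs_VX_le μ hμ (x + c); have v2 := B.abs_VX_le μ hμ x
    have v3 := B.abs_VY_le μ hμ (x + c); have v4 := B.abs_VY_le μ hμ x
    have a2 := B.abs_AX_le μ hμ x; have a4 := B.abs_AY_le μ hμ x
    have s1 : |bandVX μ (x + c) + bandVX μ x| ≤ 2 * B.smax := (abs_add_le _ _).trans (by linarith)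
    have s2 : |bandVY μ (x + c) + bandVY μ x| ≤ 2 * B.smax := (abs_add_le _ _).trans (by linarith)
    have pd1 : |Real.cos (SXP μ P (x + c) x) * (bandVX μ (x + c) + bandVX μ x)| ≤ 2 * B.smax := by
      rw [abs_mul]
      calc _ ≤ 1 * (2 * B.smax) := mul_le_mul (Real.abs_cos_le_one _) s1 (abs_nonneg _) zero_le_one
        _ = 2 * B.smax := one_mul _
    have pd2 : |Real.cos (SYP μ P (x + c) x) * (bandVY μ (x + c) + bandVY μ x)| ≤ 2 * B.smax := by
      rw [abs_mul]
      calc _ ≤ 1 * (2 * B.smax) := mul_le_mul (Real.abs_cos_le_one _) s2 (abs_nonneg _) zero_le_one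
        _ = 2 * B.smax := one_mul _
    have t1 : |Real.cos (SXP μ P (x + c) x) * (bandVX μ (x + c) + bandVX μ x) * bandVX μ x +
          Real.sin (SXP μ P (x + c) x) * bandAX μ x| ≤ 2 * B.smax * B.smax + 1 * B.A2 :=
      abs_two_term_le pd1 v2 (Real.abs_sin_le_one _) a2
    have t2 : |Real.cos (SYP μ P (x + c) x) * (bandVY μ (x + c) + bandVY μ x) * bandVY μ x +
          Real.sin (SYP μ P (x + c) x) * bandAY μ x| ≤ 2 * B.smax * B.smax + 1 * B.A2 :=
      abs_two_term_le pd2 v4 (Real.abs_sin_le_one _) a4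
    calc _ ≤ |2 * (Real.cos (SXP μ P (x + c) x) * (bandVX μ (x + c) + bandVX μ x) * bandVX μ x +
          Real.sin (SXP μ P (x + c) x) * bandAX μ x)| +
        |2 * (Real.cos (SYP μ P (x + c) x) * (bandVY μ (x + c) + bandVY μ x) * bandVY μ x +
          Real.sin (SYP μ P (x + c) x) * bandAY μ x)| := abs_add_le _ _
      _ ≤ 8 * B.smax ^ 2 + 4 * B.A2 := by rw [abs_mul, abs_mul, abs_two]; nlinarith
  have h := (convex_univ (𝕜 := ℝ) (E := ℝ)).norm_image_sub_le_of_norm_hasDerivWithin_le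
    (f := fun x => h3P μ P (x + c) x)
    (fun u _ => (hasDerivAt_h3P_shift B hμ P c u).hasDerivWithinAt)
    (fun u _ => by rw [Real.norm_eq_abs]; exact hbound u) (mem_univ z') (mem_univ z)
  rw [Real.norm_eq_abs, Real.norm_eq_abs] at h
  exact h

/-- **The count along a fixed Cooper-range shift for an arbitrary offset** `c = k w`, `0 < |c - π| ≤ τ`, GATED by the
leg-2 partial: `#{a < N : |h_P(θ_a, θ_a + c)| ≤ δ, |∂₂ h_P(θ_a, θ_a + c)| ≤ λ} ≤ C₅ · 2 · (2δ/(h_min |c - π| w) + 1)`,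
`C₅ = 2π / min (η₀/(8 A₂ τ)) (λ/(8 s_max² + 4 A₂)) + 1`, `δ ≤ η₀/2`. The gate is what makes the shift line transversal
for an offset off the curve (`odd_transversalP`). -/
theorem count_odd_shift_offset {P : ℝ × ℝ} {w δ τ η₀ lam c : ℝ} (hw : 0 < w) {N : ℕ} (hN : (N : ℝ) * w = 2 * π)
    (hδ : 0 ≤ δ) (hη₀ : 0 < η₀) (hlam : 0 < lam) (hτ : 0 < τ) (hδη : δ ≤ η₀ / 2)
    (hlo : a ≤ μ - η₀) (hhi : μ + η₀ ≤ b) (hc : |c - π| ≤ τ) (hcpos : 0 < |c - π|)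
    (hsmall : 4 * B.A2 * (η₀ / B.Dtmin + B.smax * (B.Cg * (lam + 2 * B.smax * (η₀ / B.Dtmin)) + τ)) ≤ B.hmin) :
    ((((Finset.range N).filter fun i : ℕ => |hfunP μ P (w / 2 + i * w) (w / 2 + i * w + c)| ≤ δ ∧
        |h3P μ P (w / 2 + i * w + c) (w / 2 + i * w)| ≤ lam).card : ℝ)) ≤
      (2 * π / min (η₀ / (2 * (4 * B.A2 * τ))) (lam / (8 * B.smax ^ 2 + 4 * B.A2)) + 1) *
        (2 * ((2 * δ / (B.hmin * |c - π|)) / w + 1)) := by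
  obtain ⟨h1, h2⟩ := B.level hμ
  have hA := B.A2_pos; have hh := B.hmin_pos; have hs := B.smax_pos
  have h := gridCount_L3G (g := fun x => hfunP μ P x (x + c))
    (g' := fun x => 2 * Real.sin (SXP μ P x (x + c)) * (bandVX μ x + bandVX μ (x + c)) +
        2 * Real.sin (SYP μ P x (x + c)) * (bandVY μ x + bandVY μ (x + c)))
    (Γ := fun x => h3P μ P (x + c) x)
    (hasDerivAt_hfunP_diag h1 h2 P c) (M₁ := 4 * B.A2 * τ) (MΓ := 8 * B.smax ^ 2 + 4 * B.A2)
    (lam := B.hmin * |c - π|) (η₀ := η₀) (Λ := lam) (δ := δ) (by positivity) (by positivity) (by positivity) hη₀ hlam hδ hδη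
    (fun z => (abs_diag_deriv_oddP_le B hμ P c z).trans (by nlinarith [abs_nonneg (c - π)]))
    (abs_h3P_shift_sub_le B hμ P c)
    (fun z hz hΓ => odd_transversalP B hμ (lam := 2 * lam) hlo hhi hz hΓ hc (by linarith [hsmall]))
    (x₀ := w / 2) hw N
  rw [hN] at h
  exact h

/-- **The Cooper range in total, arbitrary offset**: `Σ_{|kw - π| ≤ τ} #{a : Q'(a, k)} ≤
N + 2 C₅ ((2δ/(h_min w)) (2 (1 + log N))/w + N)`; the `log N` is the harmonic sum over the shifts (present for every
offset near the curve, sharp for an offset on it); the exact Cooper shift `k = N_h` contributes at most `N`. -/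
theorem count_odd_total_offset {P : ℝ × ℝ} {w δ lam τ η₀ : ℝ} (hw : 0 < w) {N Nh : ℕ} (hN : (N : ℝ) * w = 2 * π)
    (hNh : (Nh : ℝ) * w = π) (hNN : N = 2 * Nh) (hδ : 0 < δ) (hη₀ : 0 < η₀) (hlam : 0 < lam) (hτ : 0 < τ)
    (hδη : δ ≤ η₀ / 2) (hlo : a ≤ μ - η₀) (hhi : μ + η₀ ≤ b)
    (hsmall : 4 * B.A2 * (η₀ / B.Dtmin + B.smax * (B.Cg * (lam + 2 * B.smax * (η₀ / B.Dtmin)) + τ)) ≤ B.hmin) :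
    ∑ k ∈ (Finset.range N).filter (fun k : ℕ => |(k : ℝ) * w - π| ≤ τ), ((((Finset.range N).filter fun i : ℕ =>
        |hfunP μ P (w / 2 + i * w) (w / 2 + i * w + k * w)| ≤ δ ∧
        |h3P μ P (w / 2 + i * w) (w / 2 + i * w + k * w)| < lam ∧
        |h3P μ P (w / 2 + i * w + k * w) (w / 2 + i * w)| < lam).card : ℝ)) ≤
      N + 2 * (2 * π / min (η₀ / (2 * (4 * B.A2 * τ))) (lam / (8 * B.smax ^ 2 + 4 * B.A2)) + 1) *
        ((2 * δ / (B.hmin * w)) * (2 * (1 + Real.log N)) / w + N) := by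
  have hA := B.A2_pos; have hh := B.hmin_pos; have hs := B.smax_pos
  have hNh0 : 0 < Nh := by
    rcases Nat.eq_zero_or_pos Nh with h0 | h0
    · exfalso; rw [h0] at hNh; simp at hNh; linarith [Real.pi_pos]
    · exact h0
  have hNhN : Nh < N := by omega
  set S := (Finset.range N).filter (fun k : ℕ => |(k : ℝ) * w - π| ≤ τ) with hS
  set f : ℕ → ℝ := fun k => ((((Finset.range N).filter fun i : ℕ =>
        |hfunP μ P (w / 2 + i * w) (w / 2 + i * w + k * w)| ≤ δ ∧
        |h3P μ P (w / 2 + i * w) (w / 2 + i * w + k * w)| < lam ∧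
        |h3P μ P (w / 2 + i * w + k * w) (w / 2 + i * w)| < lam).card : ℝ)) with hf
  have hf0 : ∀ k, 0 ≤ f k := fun k => by positivity
  have hfN : ∀ k, f k ≤ N := by
    intro k
    rw [hf]; dsimp only
    have := Finset.card_filter_le (Finset.range N) (fun i : ℕ =>
        |hfunP μ P (w / 2 + i * w) (w / 2 + i * w + k * w)| ≤ δ ∧
        |h3P μ P (w / 2 + i * w) (w / 2 + i * w + k * w)| < lam ∧
        |h3P μ P (w / 2 + i * w + k * w) (w / 2 + i * w)| < lam)
    rw [Finset.card_range] at this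
    exact_mod_cast this
  -- split `S` into the exact Cooper shift `k = Nh` and the rest
  rw [← Finset.sum_filter_add_sum_filter_not S (fun k : ℕ => k = Nh)]
  have htriv : ∑ k ∈ S.filter (fun k : ℕ => k = Nh), f k ≤ N := by
    have hsub : S.filter (fun k : ℕ => k = Nh) ⊆ {Nh} := by
      intro k hk
      rw [Finset.mem_filter] at hk
      rw [Finset.mem_singleton]; exact hk.2
    calc ∑ k ∈ S.filter (fun k : ℕ => k = Nh), f k ≤ ∑ k ∈ ({Nh} : Finset ℕ), f k :=
          Finset.sum_le_sum_of_subset_of_nonneg hsub fun k _ _ => hf0 k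
      _ = f Nh := Finset.sum_singleton _ _
      _ ≤ N := hfN Nh
  have hgood : ∑ k ∈ S.filter (fun k : ℕ => ¬ k = Nh), f k ≤
      2 * (2 * π / min (η₀ / (2 * (4 * B.A2 * τ))) (lam / (8 * B.smax ^ 2 + 4 * B.A2)) + 1) *
        ((2 * δ / (B.hmin * w)) * (2 * (1 + Real.log N)) / w + N) := by
    set C₅ := 2 * π / min (η₀ / (2 * (4 * B.A2 * τ))) (lam / (8 * B.smax ^ 2 + 4 * B.A2)) + 1 with hC₅
    have hℓ : 0 < min (η₀ / (2 * (4 * B.A2 * τ))) (lam / (8 * B.smax ^ 2 + 4 * B.A2)) :=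
      lt_min (by positivity) (by positivity)
    have hC₅0 : 0 ≤ C₅ := by positivity
    have hterm : ∀ k ∈ S.filter (fun k : ℕ => ¬ k = Nh),
        f k ≤ C₅ * (2 * ((2 * δ / (B.hmin * w)) * (1 / |(k : ℝ) - Nh|) / w + 1)) := by
      intro k hk
      rw [Finset.mem_filter, hS, Finset.mem_filter, Finset.mem_range] at hk
      obtain ⟨⟨hkN, hkτ⟩, hkNh⟩ := hk
      have hkey : |(k : ℝ) * w - π| = |(k : ℝ) - Nh| * w := by
        rw [← hNh, show (k : ℝ) * w - Nh * w = ((k : ℝ) - Nh) * w by ring, abs_mul, abs_of_pos hw]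
      have hkNh' : (k : ℝ) - Nh ≠ 0 := by
        intro h0
        have : (k : ℝ) = Nh := by linarith
        exact hkNh (by exact_mod_cast this)
      have habs : |(k : ℝ) - Nh| ≠ 0 := abs_ne_zero.2 hkNh'
      have hcpos : 0 < |(k : ℝ) * w - π| := by rw [hkey]; positivity
      have hmono : f k ≤ ((((Finset.range N).filter fun i : ℕ =>
          |hfunP μ P (w / 2 + i * w) (w / 2 + i * w + k * w)| ≤ δ ∧
          |h3P μ P (w / 2 + i * w + k * w) (w / 2 + i * w)| ≤ lam).card : ℝ)) := by
        rw [hf]; dsimp only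
        have hsub' : ((Finset.range N).filter fun i : ℕ =>
            |hfunP μ P (w / 2 + i * w) (w / 2 + i * w + k * w)| ≤ δ ∧
            |h3P μ P (w / 2 + i * w) (w / 2 + i * w + k * w)| < lam ∧
            |h3P μ P (w / 2 + i * w + k * w) (w / 2 + i * w)| < lam) ⊆
            ((Finset.range N).filter fun i : ℕ =>
              |hfunP μ P (w / 2 + i * w) (w / 2 + i * w + k * w)| ≤ δ ∧
              |h3P μ P (w / 2 + i * w + k * w) (w / 2 + i * w)| ≤ lam) := by
          intro i hi
          rw [Finset.mem_filter] at hi ⊢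
          exact ⟨hi.1, hi.2.1, hi.2.2.2.le⟩
        exact_mod_cast Finset.card_le_card hsub'
      have hL := count_odd_shift_offset B hμ (P := P) hw hN hδ.le hη₀ hlam hτ hδη hlo hhi hkτ hcpos hsmall
      refine hmono.trans (hL.trans (le_of_eq ?_))
      rw [hkey, hC₅]
      field_simp
    have hsub : S.filter (fun k : ℕ => ¬ k = Nh) ⊆ (Finset.range N).filter (fun k => k ≠ Nh) := by
      intro k hk
      rw [Finset.mem_filter, hS, Finset.mem_filter] at hk
      rw [Finset.mem_filter]
      exact ⟨hk.1.1, hk.2⟩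
    calc ∑ k ∈ S.filter (fun k : ℕ => ¬ k = Nh), f k
        ≤ ∑ k ∈ S.filter (fun k : ℕ => ¬ k = Nh),
            C₅ * (2 * ((2 * δ / (B.hmin * w)) * (1 / |(k : ℝ) - Nh|) / w + 1)) := Finset.sum_le_sum hterm
      _ ≤ ∑ k ∈ (Finset.range N).filter (fun k => k ≠ Nh),
            C₅ * (2 * ((2 * δ / (B.hmin * w)) * (1 / |(k : ℝ) - Nh|) / w + 1)) :=
          Finset.sum_le_sum_of_subset_of_nonneg hsub fun k _ _ => by positivity
      _ = (2 * C₅ * (2 * δ / (B.hmin * w)) / w) * ∑ k ∈ (Finset.range N).filter (fun k => k ≠ Nh), 1 / |(k : ℝ) - Nh|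
            + 2 * C₅ * (((Finset.range N).filter (fun k => k ≠ Nh)).card : ℝ) := by
          have hrw : ∀ k : ℕ, C₅ * (2 * ((2 * δ / (B.hmin * w)) * (1 / |(k : ℝ) - Nh|) / w + 1)) =
              (2 * C₅ * (2 * δ / (B.hmin * w)) / w) * (1 / |(k : ℝ) - Nh|) + 2 * C₅ := by
            intro k; ring
          rw [Finset.sum_congr rfl (fun k _ => hrw k), Finset.sum_add_distrib, ← Finset.mul_sum, Finset.sum_const,
            nsmul_eq_mul]
          ring
      _ ≤ (2 * C₅ * (2 * δ / (B.hmin * w)) / w) * (2 * (1 + Real.log N)) + 2 * C₅ * N := by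
          apply add_le_add
          · exact mul_le_mul_of_nonneg_left (sum_inv_abs_sub_le hNhN) (by positivity)
          · apply mul_le_mul_of_nonneg_left _ (by positivity)
            calc ((((Finset.range N).filter (fun k => k ≠ Nh)).card : ℝ)) ≤ ((Finset.range N).card : ℝ) := by
                  exact_mod_cast Finset.card_filter_le _ _
              _ = N := by rw [Finset.card_range]
      _ = 2 * C₅ * ((2 * δ / (B.hmin * w)) * (2 * (1 + Real.log N)) / w + N) := by ring
  linarith


end Assembly

end Summit.HubbardSuperconductivity.HubbardSuperconductivity.Theorems.CountPairsOffset

end
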